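import Mathlib
import Summits.ValiantsHypothesis.ValiantsHypothesis.Cruxes.OrbitDimensionBound.Lines.TorsionLadder

/-!
# F4 ON-PATH file for the rung `Torsion.SignShadow` (line `sign_covering`)

`S → Rung`: `VP_ℂ ≠ VNP_ℂ` implies the rung (one line: `dc(per_n) ≤ m_n ≤ m_n 2^{r_n}` and the on-path lemma
`torsionShadow_of_summit`), so closing the rung is NECESSARY for the summit; and the kernel's own portfolio tactic
(`intro h; aesop`) closes it (the lemma `signShadow_of_summit` is tagged `@[aesop safe apply]` in the ladder file).
Also recorded: the rung's numeric member feeds the host route's closing (`closes_rung`) and the relaxed closing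
`closes_sign`. [cite: LandsbergRessayre2017, Question 2.2]
-/

set_option linter.dupNamespace false

namespace Summit.ValiantsHypothesis.ValiantsHypothesis.Cruxes.OrbitDimensionBound.Torsion.OnPath

open Summit.ValiantsHypothesis.ValiantsHypothesis.Cruxes.OrbitDimensionBound.Torsion

/-- `S → Rung`. [cite: LandsbergRessayre2017, Question 2.2] -/
theorem rung_of_summit : _root_.ValiantsHypothesis → SignShadow :=
  signShadow_of_summit

/-- The kernel's portfolio closes `S → Rung`. [cite: LandsbergRessayre2017, Question 2.2] -/
example : _root_.ValiantsHypothesis → SignShadow := by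
  intro h; aesop

/-- `S → TorsionShadow N` for every member of the family. [cite: LandsbergRessayre2017, Question 2.2] -/
example (N : ℕ) : _root_.ValiantsHypothesis → TorsionShadow N :=
  torsionShadow_of_summit N

/-- The rung's numeric member closes the host route with the ORIGINAL crux. [cite: LandsbergRessayre2017, Thm. 2.8] -/
example (h₁ : Summit.ValiantsHypothesis.ValiantsHypothesis.Theses.FreeSubtorus.OrbitDimensionBound)
    (h₂ : SignCovering) : _root_.ValiantsHypothesis :=
  closes_rung h₁ h₂

/-- … and with the RELAXED crux (finite sign symmetry only). [cite: LandsbergRessayre2017, Question 2.2] -/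
example (h₁ : OrbitSignBound) (h₂ : SignCovering) : _root_.ValiantsHypothesis :=
  closes_sign h₁ h₂

end Summit.ValiantsHypothesis.ValiantsHypothesis.Cruxes.OrbitDimensionBound.Torsion.OnPath
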